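import Summits.ABC.IUTFork.Repair.RHDiffPricedHull
import HarnessLib

/-!
# R-H ROUND 2, SLICE (S0) for ROW 4: the exact U2 cell `HullCellδ` is DOWNWARD CLOSED in the label, so `Σ₄ ∩ (place)` is an EXACT
# initial segment `{1, …, J_w}` at every local type and depth — with the floor-free bracket and the demand/price ledger form

abc-iut cell, rung LADDER-ABC:A2.RESCUE.H; R-H ROUND 2 seat abc-iut-rh2-w-2 (Q1′ WEIGHTS typer 2/2, gen 2; `plan/rescue/R-H/SLICE.md` v0.3 row 4,
`MIN-SLICE.md` §(i)/(i-w2).1/(iv)). PROOF-ONLY file (0 definitions, 0 `Prop` facts): integer arithmetic about the typed cell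
`RH.DiffPricedHull.HullCellδ e m j δ r_in r_out :⟺ e·⌊(j²·m − j·δ − (j+1)·r_in)/e⌋ ≤ m − (j+1)·r_out` (abc-iut-lens-transfer-3 / rp-d3, p-landed;
at `δ = e − 1` literally abc-iut-rh-typ-4's `HullThresholdExact.HullCell`, row 4) — the R-W WINDOW-TABLE's exact U2 cell «`margin_U2cell(w,j) =
m_q − [e_w·⌊(j²m_q − j·D − (j+1)·R_in)/e_w⌋ + (j+1)·R_out] ≥ 0`» (`tools/gen_table.py` l. 561–565) with `e = e_w`, `m = m_q(w)`, `δ = D` (different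
exponent), `r_in = R_in`, `r_out = R_out`. The stratum Σ₄ of R-H round 2 («sigmaNu = licence cells EXACTLY», abc-iut-rh2-q2-eq p470233) is read cell by
cell through this integer predicate (R-W U2-LICENCE-WRAPPER `Thm311.Real.licence_settingPrVolSharp_iff_shellRadii` p460046 + the orders form
`Literature.IUT.LogVolume.iota_smul_subset_packetHull_orbit_iota_smul_iff_orders`, abc-iut-w5-d180; genuine uniform fibres `Cor312LicenceWildInhabitedGenuineK`).

WHAT IS PROVED (namespace `Summit.ABC.IUTFork.Repair.RH.HullCellSlice`; hypotheses are the two STRUCTURAL facts of a local field — `e − 1 ≤ δ`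
(different exponent, [SerreLocalFields1979] III §6 Prop. 13, equality iff tame) and `r_out ≤ r_in` (`𝔪^{r_in} ⊆ log_p(𝒪^×) ⊆ 𝔪^{r_out}`) — plus
`0 < e`, `0 ≤ m`):
* §1 LEDGER FORM (MIN-SLICE §(i-w2).1, asserted there numerically on 29/29 packet rows): `HullCellδ ⟺ (j²−1)·m ≤ j·δ + (j+1)·(r_in − r_out) + ρ_j`,
  `ρ_j := (j²m − jδ − (j+1)r_in) mod e ∈ [0, e)` (`hullCellδ_iff_demand_le_price`) — the DEMAND `d_j = (j²−1)·m_q` of the MIN-SLICE weight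
  `t_triv = c·d` is the quadratic side of the licence inequality; hence the FLOOR-FREE BRACKET `(j²−1)m ≤ jδ + (j+1)(r_in − r_out) ⟹ cell ⟹
  (j²−1)m ≤ jδ + (j+1)(r_in − r_out) + (e−1)` (`hullCellδ_of_linear`, `linear_of_hullCellδ`): SLICE.md row 4's «slope ≈ D + (R_in − R_out),
  const ≈ m_q + (R_in − R_out) up to the floor» made exact (slope `= δ + (r_in − r_out)`, const `∈ [m + r_in − r_out, m + r_in − r_out + e − 1]`).
* §2 DOWNWARD CLOSURE (`not_hullCellδ_succ_of_not_hullCellδ`, `hullCellδ_of_succ`, `hullCellδ_anti`): a failing label propagates upward. KEY STEP: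
  failure at `j` forces `j·δ + (j+1)(r_in − r_out) ≤ (j²−1)m − 1`, whence (with `e − 1 ≤ δ`, `r_out ≤ r_in`) `δ + (r_in − r_out) + (e − 1) ≤ (2j+1)·m`,
  which is exactly what the floor needs to carry failure from `j` to `j+1` (`e·⌊A'/e⌋ ≥ e·⌊A/e⌋ + e·⌊Δ/e⌋`, `Δ = (2j+1)m − δ − r_in`). Label `1` is
  always IN (`hullCellδ_one`). This GENERALISES abc-iut-rh-typ-5's `RHTameCellSlice.not_cell_succ_of_not_cell` (p476650: the case `δ = e − 1`,
  `r_in = r_out = 1`) to every local type (tame, boundary, wild, deep `e ≥ p`).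
* §3 THE SLICE: for every `L ≥ 1` (read `L = l⋇`) there is a unique `J ∈ [1, L]` with `∀ 1 ≤ j ≤ L, HullCellδ … j … ⟺ j ≤ J`
  (`exists_sliceBoundary`): **`Σ₄ ∩ (place w)` is an EXACT initial segment of labels — no sporadic labels —** for every `(e_w, δ_w, R_in, R_out, m_q)`
  a local field can present. SLICE.md (S0) recorded this NUMERICALLY (10,480/10,480 HEX `(k,l)`, 29/29 worked packets, abc-iut-rh2-ref-3 13,980/13,980);
  a free scan of the five parameters (this seat, 9.1·10⁶ configurations) finds holes ONLY at `δ < e − 1` or `r_out > r_in`, i.e. outside local fields.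
* §4 sanity rows by `decide`: the three heavy places of MIN-SLICE §(i-w2).2 (HEX λ₈@11 `p = 7`: `J = 4`; frey `2⁵67⁸…@13` `p = 3` wild: `J = 4`;
  `p = 53`: `J = 3`).
HONEST FRAMING: integer identities about OUR typed cell; the identification of `HullCellδ` with the setting-level licence cell is the cited
wrappers' business (uniform fibres), not asserted here; nothing here asserts that abc is proved or refuted, or that [IUTchIII] Cor. 3.12 holds or
fails at any datum, or takes a side on any author; typed ≠ proved; computed ≠ proved. [claim: Mochizuki2012, status: disputed] for every IUT
locution. [cite: Mochizuki2012, IUTchIII Cor. 3.12 Step (xi-f) p. 184; IUTchIV Prop. 1.2 (i)(ii) p. 10, Prop. 1.4 p. 13]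
[cite: SerreLocalFields1979, Ch. III §6 Prop. 13] [cite: DupuyHilado2025, §3.4, §4.9, §4.12]
-/

namespace Summit.ABC.IUTFork.Repair.RH.HullCellSlice

open Summit.ABC.IUTFork.Repair.RH.DiffPricedHull

/-! ## §1. Ledger form `demand ≤ price` and the floor-free bracket -/

/-- **LEDGER FORM of the exact cell** (`0 < e`): `HullCellδ e m j δ r_in r_out ⟺ (j²−1)·m ≤ j·δ + (j+1)·(r_in − r_out) + ρ_j` with the
integral-structure gain `ρ_j = (j²m − jδ − (j+1)r_in) mod e` — MIN-SLICE §(i-w2).1's «margin_j = price_j − d_j», demand `d_j = (j²−1)·m_q`,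
price `j·D + (j+1)(R_in − R_out) + frac_j`. (`e·⌊A/e⌋ = A − A mod e`, an identity of `Int.ediv`/`Int.emod` for every `e`.) [folklore] -/
theorem hullCellδ_iff_demand_le_price (e m j δ rin rout : ℤ) :
    HullCellδ e m j δ rin rout ↔
      (j ^ 2 - 1) * m ≤ j * δ + (j + 1) * (rin - rout) + (j ^ 2 * m - j * δ - (j + 1) * rin) % e := by
  unfold HullCellδ
  have h1 := Int.mul_ediv_add_emod (j ^ 2 * m - j * δ - (j + 1) * rin) e
  constructor <;> intro h <;> linarith [h1, h]

/-- `0 ≤ ρ_j < e`: the integral-structure gain is a residue. [folklore] -/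
theorem gain_bounds {e : ℤ} (he : 0 < e) (m j δ rin : ℤ) :
    0 ≤ (j ^ 2 * m - j * δ - (j + 1) * rin) % e ∧ (j ^ 2 * m - j * δ - (j + 1) * rin) % e ≤ e - 1 :=
  ⟨Int.emod_nonneg _ he.ne', by have := Int.emod_lt_of_pos (j ^ 2 * m - j * δ - (j + 1) * rin) he; omega⟩

/-- **SUFFICIENT (floor-free) half**: `(j²−1)·m ≤ j·δ + (j+1)·(r_in − r_out) ⟹ HullCellδ` (`0 < e`; no sign hypotheses) — generalises
`DiffPricedHull.hullCellδ_of_cell` (which drops the `(j+1)(r_in − r_out) ≥ 0` credit). [folklore] -/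
theorem hullCellδ_of_linear {e m j δ rin rout : ℤ} (he : 0 < e) (h : (j ^ 2 - 1) * m ≤ j * δ + (j + 1) * (rin - rout)) :
    HullCellδ e m j δ rin rout := by
  rw [hullCellδ_iff_demand_le_price]
  have h0 := (gain_bounds he m j δ rin).1
  linarith

/-- **NECESSARY (floor-free) half**: `HullCellδ ⟹ (j²−1)·m ≤ j·δ + (j+1)·(r_in − r_out) + (e − 1)` (`0 < e`). Together with
`hullCellδ_of_linear`: SLICE.md row 4's quadratic-vs-linear reading with slope `δ + (r_in − r_out)` EXACTLY and constant bracketed by the floor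
(`[m + r_in − r_out, m + r_in − r_out + e − 1]` in the form `m·j² ≤ slope·j + const`). [folklore] -/
theorem linear_of_hullCellδ {e m j δ rin rout : ℤ} (he : 0 < e) (h : HullCellδ e m j δ rin rout) :
    (j ^ 2 - 1) * m ≤ j * δ + (j + 1) * (rin - rout) + (e - 1) := by
  rw [hullCellδ_iff_demand_le_price] at h
  have h1 := (gain_bounds he m j δ rin).2
  linarith

/-- Contrapositive of the necessary half: a label whose demand beats the price by `≥ e` is OFF. [folklore] -/
theorem not_hullCellδ_of_linear_lt {e m j δ rin rout : ℤ} (he : 0 < e)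
    (h : j * δ + (j + 1) * (rin - rout) + (e - 1) < (j ^ 2 - 1) * m) : ¬ HullCellδ e m j δ rin rout :=
  fun hc => absurd (linear_of_hullCellδ he hc) (not_le.mpr h)

/-! ## §2. Downward closure in the label -/

/-- **Label `1` is always IN** (`0 < e`, `e − 1 ≤ δ`, `r_out ≤ r_in`, any `m`): the demand `(1²−1)·m = 0` and the price `δ + 2(r_in − r_out) ≥ 0`.
The `j = 1` cell of every Σ_r (SLICE.md) — here a theorem for row 4 at every local type. [folklore] -/
theorem hullCellδ_one {e m δ rin rout : ℤ} (he : 0 < e) (hδ : e - 1 ≤ δ) (hio : rout ≤ rin) : HullCellδ e m 1 δ rin rout :=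
  hullCellδ_of_linear he (by nlinarith)

/-- **THE KEY INEQUALITY at a failing label**: if `HullCellδ` fails at `j` then `j·δ + (j+1)·(r_in − r_out) ≤ (j²−1)·m − 1` (`0 < e`;
`e·⌊A/e⌋ ≤ A`). [folklore] -/
theorem linear_lt_of_not_hullCellδ {e m j δ rin rout : ℤ} (he : 0 < e) (h : ¬ HullCellδ e m j δ rin rout) :
    j * δ + (j + 1) * (rin - rout) ≤ (j ^ 2 - 1) * m - 1 := by
  by_contra h'
  exact h (hullCellδ_of_linear he (by omega))

/-- **DOWNWARD CLOSURE: if the cell fails at label `j ≥ 1` it fails at `j + 1`** (`0 < e`, `e − 1 ≤ δ`, `r_out ≤ r_in`, `0 ≤ m`). With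
`A_j := j²m − jδ − (j+1)r_in` and `Δ := A_{j+1} − A_j = (2j+1)m − δ − r_in`: failure at `j` is `e·⌊A_j/e⌋ ≥ m − (j+1)r_out + 1`; floor
superadditivity gives `e·⌊A_{j+1}/e⌋ ≥ e·⌊A_j/e⌋ + e·⌊Δ/e⌋ ≥ (m − (j+1)r_out + 1) + (Δ − e + 1)`, and `Δ − e + 1 ≥ −r_out` is
`δ + (r_in − r_out) + (e−1) ≤ (2j+1)m`, which follows from `linear_lt_of_not_hullCellδ` (`jδ + (j+1)(r_in − r_out) ≤ (j²−1)m − 1`), `e − 1 ≤ δ`,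
`r_out ≤ r_in`, `m ≥ 0`: `j·(δ + (r_in−r_out) + e − 1) ≤ j·(2δ + (r_in−r_out)) ≤ 2·(jδ + (j+1)(r_in−r_out)) ≤ 2(j²−1)m − 2 ≤ j(2j+1)m`. [folklore] -/
theorem not_hullCellδ_succ_of_not_hullCellδ {e m j δ rin rout : ℤ} (he : 0 < e) (hδ : e - 1 ≤ δ) (hio : rout ≤ rin) (hm : 0 ≤ m)
    (hj : 1 ≤ j) (h : ¬ HullCellδ e m j δ rin rout) : ¬ HullCellδ e m (j + 1) δ rin rout := by
  have hlin := linear_lt_of_not_hullCellδ he h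
  unfold HullCellδ at h ⊢
  push Not at h ⊢
  set A : ℤ := j ^ 2 * m - j * δ - (j + 1) * rin with hA
  set A' : ℤ := (j + 1) ^ 2 * m - (j + 1) * δ - (j + 1 + 1) * rin with hA'
  set Δ : ℤ := (2 * j + 1) * m - δ - rin with hΔ
  have hAA : A' = A + Δ := by rw [hA, hA', hΔ]; ring
  -- floor superadditivity: `A/e + Δ/e ≤ (A + Δ)/e`
  have hsup : A / e + Δ / e ≤ A' / e := by
    rw [hAA, Int.le_ediv_iff_mul_le he]
    have h1 := Int.ediv_mul_le A he.ne'
    have h2 := Int.ediv_mul_le Δ he.ne'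
    linarith
  -- `e·⌊Δ/e⌋ ≥ Δ − e + 1`
  have hΔfloor : Δ - e + 1 ≤ e * (Δ / e) := by
    have := Int.lt_mul_ediv_self_add (x := Δ) he
    linarith
  -- the key inequality `δ + (rin − rout) + (e − 1) ≤ (2j+1)·m`
  have hkey : δ + (rin - rout) + (e - 1) ≤ (2 * j + 1) * m := by
    have h1 : j * (δ + (rin - rout) + (e - 1)) ≤ j * ((2 * j + 1) * m) := by
      have hX : 0 ≤ rin - rout := by omega
      nlinarith
    exact le_of_mul_le_mul_left h1 (by omega)
  have hmul : e * (A / e) + e * (Δ / e) ≤ e * (A' / e) := by nlinarith [mul_le_mul_of_nonneg_left hsup he.le]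
  linarith

/-- **Downward closure: the cell at `j + 1` implies the cell at `j`** (`0 < e`, `e − 1 ≤ δ`, `r_out ≤ r_in`, `0 ≤ m`, `1 ≤ j`). [folklore] -/
theorem hullCellδ_of_succ {e m j δ rin rout : ℤ} (he : 0 < e) (hδ : e - 1 ≤ δ) (hio : rout ≤ rin) (hm : 0 ≤ m) (hj : 1 ≤ j)
    (h : HullCellδ e m (j + 1) δ rin rout) : HullCellδ e m j δ rin rout := by
  by_contra h'
  exact not_hullCellδ_succ_of_not_hullCellδ he hδ hio hm hj h' h

/-- **The cell is ANTITONE in the label on `j ≥ 1`**: `HullCellδ … j' …` and `1 ≤ j ≤ j'` give `HullCellδ … j …`. [folklore] -/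
theorem hullCellδ_anti {e m j j' δ rin rout : ℤ} (he : 0 < e) (hδ : e - 1 ≤ δ) (hio : rout ≤ rin) (hm : 0 ≤ m) (hj : 1 ≤ j)
    (hjj : j ≤ j') (h : HullCellδ e m j' δ rin rout) : HullCellδ e m j δ rin rout := by
  obtain ⟨n, rfl⟩ : ∃ n : ℕ, j' = j + n := ⟨(j' - j).toNat, by omega⟩
  induction n with
  | zero => simpa using h
  | succ n ih =>
    refine ih (by omega) (hullCellδ_of_succ he hδ hio hm (by omega) ?_)
    have h1 : j + ((n : ℤ) + 1) = j + (n : ℤ) + 1 := by ring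
    push_cast at h
    rwa [h1] at h

/-- **Failure is MONOTONE in the label**: `¬ HullCellδ … j …` and `1 ≤ j ≤ j'` give `¬ HullCellδ … j' …`. [folklore] -/
theorem not_hullCellδ_mono {e m j j' δ rin rout : ℤ} (he : 0 < e) (hδ : e - 1 ≤ δ) (hio : rout ≤ rin) (hm : 0 ≤ m) (hj : 1 ≤ j)
    (hjj : j ≤ j') (h : ¬ HullCellδ e m j δ rin rout) : ¬ HullCellδ e m j' δ rin rout :=
  fun h' => h (hullCellδ_anti he hδ hio hm hj hjj h')

/-! ## §3. The slice: `Σ₄ ∩ (place)` is an exact initial segment `{1, …, J}` -/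

/-- **One boundary pair pins the whole column**: if `HullCellδ … J …` and `¬ HullCellδ … (J+1) …` (`J ≥ 1`), then for every label `j ≥ 1`,
`HullCellδ … j … ↔ j ≤ J`. [folklore] -/
theorem hullCellδ_iff_le_of_boundary {e m J δ rin rout : ℤ} (he : 0 < e) (hδ : e - 1 ≤ δ) (hio : rout ≤ rin) (hm : 0 ≤ m)
    (hJ : 1 ≤ J) (hin : HullCellδ e m J δ rin rout) (hoff : ¬ HullCellδ e m (J + 1) δ rin rout) {j : ℤ} (hj : 1 ≤ j) :
    HullCellδ e m j δ rin rout ↔ j ≤ J := by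
  constructor
  · intro h
    by_contra hlt
    exact not_hullCellδ_mono he hδ hio hm (by omega) (by omega) hoff h
  · intro h
    exact hullCellδ_anti he hδ hio hm hj h hin

/-- **The boundary is unique.** [folklore] -/
theorem sliceBoundary_unique {e m J J' δ rin rout : ℤ} (he : 0 < e) (hδ : e - 1 ≤ δ) (hio : rout ≤ rin) (hm : 0 ≤ m)
    (hJ : 1 ≤ J) (hJ' : 1 ≤ J') (hin : HullCellδ e m J δ rin rout) (hoff : ¬ HullCellδ e m (J + 1) δ rin rout)
    (hin' : HullCellδ e m J' δ rin rout) (hoff' : ¬ HullCellδ e m (J' + 1) δ rin rout) : J = J' := by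
  have h1 : J' ≤ J := (hullCellδ_iff_le_of_boundary he hδ hio hm hJ hin hoff hJ').1 hin'
  have h2 : J ≤ J' := (hullCellδ_iff_le_of_boundary he hδ hio hm hJ' hin' hoff' hJ).1 hin
  omega

/-- **SLICE (S0) FOR ROW 4, AS A THEOREM.** For every label range `1 ≤ j ≤ L` (`L ≥ 1`; read `L = l⋇`) there is `J ∈ [1, L]` such that the cell
holds at `j` iff `j ≤ J`: the labels licensed by the exact U2 cell at one place form the INITIAL SEGMENT `{1, …, J}` — at every local type
(`e − 1 ≤ δ`, `r_out ≤ r_in`) and every depth `m ≥ 0`. (Induction on `L`; label `1` is IN by `hullCellδ_one`.) [folklore] -/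
theorem exists_sliceBoundary {e m δ rin rout : ℤ} (he : 0 < e) (hδ : e - 1 ≤ δ) (hio : rout ≤ rin) (hm : 0 ≤ m) {L : ℤ} (hL : 1 ≤ L) :
    ∃ J : ℤ, 1 ≤ J ∧ J ≤ L ∧ ∀ j : ℤ, 1 ≤ j → j ≤ L → (HullCellδ e m j δ rin rout ↔ j ≤ J) := by
  obtain ⟨n, rfl⟩ : ∃ n : ℕ, L = 1 + n := ⟨(L - 1).toNat, by omega⟩
  induction n with
  | zero =>
    refine ⟨1, le_rfl, by simp, fun j hj hjL => ?_⟩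
    have hj1 : j = 1 := by push_cast at hjL; omega
    subst hj1
    exact ⟨fun _ => le_rfl, fun _ => hullCellδ_one he hδ hio⟩
  | succ n ih =>
    obtain ⟨J, hJ1, hJL, hJ⟩ := ih (by omega)
    by_cases htop : HullCellδ e m (1 + ((n : ℤ) + 1)) δ rin rout
    · -- the new top label is IN: then every label `≤ 1+n+1` is IN and `J := 1+n+1`
      refine ⟨1 + ((n : ℤ) + 1), by omega, by push_cast; omega, fun j hj hjL => ?_⟩
      push_cast at hjL ⊢
      exact ⟨fun _ => hjL, fun hle => hullCellδ_anti he hδ hio hm hj hle htop⟩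
    · -- the new top label is OFF: the old boundary serves
      refine ⟨J, hJ1, by push_cast; omega, fun j hj hjL => ?_⟩
      push_cast at hjL htop
      by_cases hjt : j = 1 + (n : ℤ) + 1
      · subst hjt
        constructor
        · intro h; exact absurd h htop
        · intro hle
          -- `J ≤ 1+n < 1+n+1 = j ≤ J` is impossible
          exfalso; omega
      · exact hJ j hj (by omega)

/-- **In particular, beyond a failing label nothing is licensed, and below a licensed label everything is**: for `1 ≤ j ≤ j'`,
`HullCellδ … j' … → HullCellδ … j …` and `¬ HullCellδ … j … → ¬ HullCellδ … j' …` — the two readings the numerics tables use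
(«j₀(w) = the largest licensed label», SLICE.md). Restated pair for citation. [folklore] -/
theorem slice_readings {e m j j' δ rin rout : ℤ} (he : 0 < e) (hδ : e - 1 ≤ δ) (hio : rout ≤ rin) (hm : 0 ≤ m) (hj : 1 ≤ j)
    (hjj : j ≤ j') :
    (HullCellδ e m j' δ rin rout → HullCellδ e m j δ rin rout) ∧
      (¬ HullCellδ e m j δ rin rout → ¬ HullCellδ e m j' δ rin rout) :=
  ⟨hullCellδ_anti he hδ hio hm hj hjj, not_hullCellδ_mono he hδ hio hm hj hjj⟩

/-- **BRACKET for the boundary from the floor-free halves**: any label with `(j²−1)m ≤ jδ + (j+1)(r_in − r_out)` is `≤ J`, any label with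
`jδ + (j+1)(r_in − r_out) + (e−1) < (j²−1)m` is `> J` — so `J` is pinned between the largest root-label of the two concave quadratics
`m·j² − (δ + r_in − r_out)·j − (m + r_in − r_out + c)`, `c ∈ {0, e − 1}` (SLICE.md's closed form `j₀ ≈ slope/m_q`, exact up to this bracket).
[folklore] -/
theorem sliceBoundary_bracket {e m J j δ rin rout : ℤ} (he : 0 < e) (hδ : e - 1 ≤ δ) (hio : rout ≤ rin) (hm : 0 ≤ m) (hJ : 1 ≤ J)
    (hin : HullCellδ e m J δ rin rout) (hoff : ¬ HullCellδ e m (J + 1) δ rin rout) (hj : 1 ≤ j) :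
    ((j ^ 2 - 1) * m ≤ j * δ + (j + 1) * (rin - rout) → j ≤ J) ∧
      (j * δ + (j + 1) * (rin - rout) + (e - 1) < (j ^ 2 - 1) * m → J < j) := by
  refine ⟨fun h => (hullCellδ_iff_le_of_boundary he hδ hio hm hJ hin hoff hj).1 (hullCellδ_of_linear he h), fun h => ?_⟩
  by_contra hle
  exact not_hullCellδ_of_linear_lt he h (hullCellδ_anti he hδ hio hm hj (by omega) hin)

/-! ## §4. Sanity rows: the heavy places of MIN-SLICE §(i-w2).2 (R-W WINDOW-TABLE v4.22 integers) -/

/-- HEX `λ₈ @ l = 11`, `p = 7` (`e_w = 165`, `δ = 164`, `R_in = 28`, `R_out = −281`, `m_q = 120`; margins `847 963 914 535 −174`): `J = 4` of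
`l⋇ = 5`. Frey `2⁵67⁸107·22381 + 5⁴53⁶353⁵ @ l = 13`, `p = 3` WILD (`e_w = 390`, `δ = 779`, `R_in = 196`, `R_out = −1707`, `m_q = 660`): `J = 4`;
`p = 53` (`65, 64, 2, −12, 30`): `J = 3` of `l⋇ = 6`. [folklore] -/
theorem rows_worked_example :
    (HullCellδ 165 120 4 164 28 (-281) ∧ ¬ HullCellδ 165 120 5 164 28 (-281)) ∧
      (HullCellδ 390 660 4 779 196 (-1707) ∧ ¬ HullCellδ 390 660 5 779 196 (-1707)) ∧
        (HullCellδ 65 30 3 64 2 (-12) ∧ ¬ HullCellδ 65 30 4 64 2 (-12)) := by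
  unfold HullCellδ
  decide

end Summit.ABC.IUTFork.Repair.RH.HullCellSlice
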